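/-
Copyright (c) 2026 the pub-hodgecm-mathlib formalisation cell (harness21).  Prover seat hodgecm-mathlib-K2E4-p10 (g6), Track B ∕ K2-LIT, h413 =
`stmt-HodgeConjecture-24833`, line `K2_E1_TraceFormulaBeta`, campaign «EIS-R7-BL-SPH-3»: THE (L4) GLUE — from the EXPORTS₃ package `(Ec, P, c̃)`, the operator road's truncated family
and its two `L²` bounds, to the capstone's `hreg` and `hres` at `U(2,1)` over a CM field (dealer K2E1-plan (g6) (89)∕(123)∕(125), 2026-09-04).
-/
import Summits.HodgeConjecture.HodgeConjecture.Theorems.K2E1SphericalEisensteinResidueCuspidalCMThree        -- THIS SEAT ★ p859768: `exists_analyticAt_remainder_cm_three` (the residue is `φ₀r`)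
import Summits.HodgeConjecture.HodgeConjecture.Theorems.K2E1SphericalEisensteinHeckeLinkFixedLevelUThree      -- THIS SEAT ★ p859801: `L²` bounds ⟹ pointwise bounds (`hbdd`, (F))
import Summits.HodgeConjecture.HodgeConjecture.Theorems.K2E1ContinuedEisensteinHeckeConstantTermCMThree      -- THIS SEAT ★ p859663: (Hk) and (E3′) continued
import Summits.HodgeConjecture.HodgeConjecture.Theorems.K2E1BLUniquenessU2                                  -- ★ P5b∕P6 (K2E1-p04): `exists_biInvariant_one_pos_re_integral_pos` (a test function with `ĥ(z₀) ≠ 0`)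
import Summits.HodgeConjecture.HodgeConjecture.Theorems.K2E1ConvexDiffCountableConnected                    -- ★ (K2E4-p11 g5): `isPreconnected_convex_diff_of_countable`
import HarnessLib

/-!
# K2·E1 — `K2E1SphericalEisensteinRegularRemainderCMThreeOfExports` ((L4) glue at `U(2,1)_{L/L⁺}`): FROM THE EXPORTS₃ PACKAGE AND THE OPERATOR ROAD'S `L²` BOUNDS TO THE CAPSTONE'S
# `hres` (`Res_{z=2}Ẽ(z)(g) = φ₀r`) AND `hreg` (`E(z)(g) − φ₀(H^z + c̃(z)H^{2−z})` extends holomorphically to `{1 < re}`)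

Track B ∕ K2-LIT, crux h413 = `stmt-HodgeConjecture-24833`, route of record `HCCMUnconditional`; cell `hodgecm-mathlib`, squad K2, ENGINE E1, campaign EIS-R7-BL-SPH-3 (R31).  Prover seat
`hodgecm-mathlib-K2E4-p10` (g6); queue of record (125) «K2E4-p10: (RES)₃∕(L4b)∕capstone₃».  THEOREMS ONLY (no `def`, no `instance`, no notation, no named-fact hypothesis, no `sorry`);
lane `--supports stmt-HodgeConjecture-24833 --as helper` (count-neutral).  Closes no socket.

WHAT IT DOES.  One theorem per capstone letter, with ALL intermediate letters of ★ p859395∕p859418∕p859768∕p859801 discharged: the domain `D := {1 < re} ∖ P` (open; preconnected by ★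
`isPreconnected_convex_diff_of_countable`; contains `B(2,ρ)∖{2}` because `2` is isolated in `P`, and the ball `B(3,1)` of the tube because `P ⊆ {re ≤ 2}`); the test functions (★ P5b
`exists_biInvariant_one_pos_re_integral_pos`: `h ≥ 0` bi-`K_U`-invariant with `Re ĥ(z₀) > 0`); (Hk)∕(E3′) continued (★ p859663); the simple-pole letter (F) and the pointwise pole exclusion
`hbdd` from the `L²` bounds (★ p859801); the residue (★ p859768); the regular remainder (★ p859395).  REMAINING LETTERS (all named, all owned): EXPORTS₃ — `P` (closed, countable, codiscrete `hPiso`, `⊆ {re ≤ 2}`,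
`2 ∈ P`), `hEmer`, `hEan`, (E4) `hE4`, (E2-bd) `hEbd`, `hEcinv`, (E2) `hEeq`; the coefficient `c̃` — `hcan` (analytic on `{1<re}∖{2}`), `hcres` (`(z−2)c̃ → r`), (E3)
`hccE` (tube constant term ★ `borelConstantTerm_sphericalEisenstein_cm_three` names it); the operator road (closer₃, K2E1-p11 (120)) — `Fam` holomorphic on `D` with `Fam z =ᵐ Λ^T Ẽ(z)` at ONE
level `T ≥ 1`; and its two `L²` bounds — `hMS2 : ‖(z−2)•Fam z‖ ≤ C` near `2` (Maass–Selberg at the pole) and `hMSP : ‖Fam z‖ ≤ C` near every `z₀ ∈ P∖{2}` (pole exclusion, (a2)∕(iii)).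
* **`hres_cm_three_of_exports`** — `∀ g, ∃ G` analytic at `2`, `G =ᶠ[𝓝[≠] 2] (z ↦ Ẽ(z)(g) − φ₀(H(g)^z + c̃(z)H(g)^{2−z}))` (= ★ p859395's binder `hres`).
* **`hreg_cm_three_of_exports`** — `∀ g, ∃ R` holomorphic on `{1 < re}` with `E(φ₀H^z)(g) = φ₀(H(g)^z + c̃(z)H(g)^{2−z}) + R z` for `2 < Re z` (= the capstone's `hreg`, ★ p859307).
HONEST LABEL: HC_CM is proved only modulo the 7 printed citations (2 remaining named inputs: hLiu418 = `stmt-HodgeConjecture-24832`, h413 = `stmt-HodgeConjecture-24833`) until rung 0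
closes; this file asserts no named fact and closes no socket; both heads are CONDITIONAL on exactly the letters listed above.
References: [MoeglinWaldspurger1995] IV.1.9–IV.1.11 · [Langlands1976] §7 · [BernsteinLapid2019] §4 p. 10 · [Garrett2018] §2.10–§2.11.
-/

set_option autoImplicit false
-- the mandated namespace repeats the single-problem summit's segment (`HodgeConjecture.HodgeConjecture`)
set_option linter.dupNamespace false

noncomputable section

open MeasureTheory Measure NumberField IsDedekindDomain Set Filter Topology Metric
open scoped ENNReal NNReal
open Literature.NumberTheory.Automorphic Literature.NumberTheory.Automorphic.UnitaryGroup AdelicGroupData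
open Summit.HodgeConjecture.HodgeConjecture.Cruxes.H413.K2E1BorelEisensteinU
open Summit.HodgeConjecture.HodgeConjecture.Cruxes.H413.K2E1SphericalEisensteinResidueLinkU (exists_tendsto_smul_sub_of_eventually_norm_le)
open Summit.HodgeConjecture.HodgeConjecture.Cruxes.H413.K2E1SphericalHeckeEigenSectionU2 (differentiable_integral_mul_borelHeight_cpow_cm)
open Summit.HodgeConjecture.HodgeConjecture.Cruxes.H413.K2E1ContinuedEisensteinHeckeConstantTermCMThree (integral_mul_continued_eq_cm_three borelConstantTerm_continued_eq_cm_three)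
open Summit.HodgeConjecture.HodgeConjecture.Cruxes.H413.K2E1SphericalEisensteinHeckeLinkFixedLevelUThree (exists_eventually_norm_le_of_family_bound exists_analyticAt_eventuallyEq_sub_mul_of_family_bound)
open Summit.HodgeConjecture.HodgeConjecture.Cruxes.H413.K2E1SphericalEisensteinResidueCuspidalCMThree (exists_analyticAt_remainder_cm_three)
open Summit.HodgeConjecture.HodgeConjecture.Cruxes.H413.K2E1SphericalEisensteinRegularRemainderCMThreeOfLetters (hreg_cm_three_of_letters)
open Summit.HodgeConjecture.HodgeConjecture.Cruxes.H413.K2E1BLUniquenessU2 (exists_biInvariant_one_pos_re_integral_pos)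
open Summit.HodgeConjecture.HodgeConjecture.Cruxes.H413.K2E1ConvexDiffCountableConnected (isPreconnected_convex_diff_of_countable)

namespace Summit.HodgeConjecture.HodgeConjecture.Cruxes.H413.K2E1SphericalEisensteinRegularRemainderCMThreeOfExports

variable (L : Type) [Field L] [NumberField L] [IsCMField L]
variable [MeasurableSpace (quasiSplit (↥(maximalRealSubfield L)) L (IsCMField.complexConj L) 3).Adelic] [BorelSpace (quasiSplit (↥(maximalRealSubfield L)) L (IsCMField.complexConj L) 3).Adelic]

/-- **THE (L4) PACKAGE FROM THE EXPORTS: `hres` AND `hbdd`.**  From EXPORTS₃ `(P, Ec)` (`P` closed, countable, codiscrete, `⊆ {re ≤ 2}`, `2 ∈ P`; analyticity off `P`, (E4), (E2-bd),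
left-`G(L⁺)`-invariance, tube agreement (E2)), the coefficient `c̃` (analytic on `{1<re}∖{2}`, `(z−2)c̃(z) → r`, tube constant term (E3)), the operator road's family `Fam` on `{1<re}∖P` at
one level `T ≥ 1`, the Maass–Selberg bound `‖(z−2)•Fam z‖ ≤ C` near `2` and the `L²` pole exclusion `‖Fam z‖ ≤ C` near each `z₀ ∈ P∖{2}`: **(i)** for every `g`, `Ẽ(z)(g) −
φ₀(H(g)^z + c̃(z)H(g)^{2−z})` extends analytically across `2` (★ p859395's `hres`); **(ii)** for every `g` and `z₀ ∈ P∖{2}` with `1 < Re z₀`, `Ẽ(z)(g)` is bounded near `z₀` (★ p859395's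
`hbdd`). [cite: MoeglinWaldspurger1995, IV.1.11] [cite: Langlands1976, §7] [cite: BernsteinLapid2019, §4 p. 10] -/
theorem hres_and_hbdd_cm_three_of_exports
    (μ : Measure (quasiSplit (↥(maximalRealSubfield L)) L (IsCMField.complexConj L) 3).automorphicQuotient) [(quasiSplit (↥(maximalRealSubfield L)) L (IsCMField.complexConj L) 3).IsAutomorphicMeasure μ]
    (ν : Measure ↥(adelicUnipotent (↥(maximalRealSubfield L)) L (IsCMField.complexConj L) 3)) [ν.IsHaarMeasure]
    {𝓕 : Set ↥(adelicUnipotent (↥(maximalRealSubfield L)) L (IsCMField.complexConj L) 3)}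
    (h𝓕N : IsFundamentalDomain ↥(rationalUnipotent (↥(maximalRealSubfield L)) L (IsCMField.complexConj L) 3) 𝓕 ν) (h𝓕c : IsCompact (closure 𝓕))
    (φ₀ : ℂ) {T : ℝ≥0} (hT : 1 ≤ T)
    (P : Set ℂ) (hPcl : IsClosed P) (hPc : P.Countable) (hP2 : ∀ z ∈ P, z.re ≤ 2) (h2P : (2 : ℂ) ∈ P) (hPiso : ∀ z₀ ∈ P, ∀ᶠ z in 𝓝[≠] z₀, z ∉ P)
    (Ec : ℂ → (quasiSplit (↥(maximalRealSubfield L)) L (IsCMField.complexConj L) 3).Adelic → ℂ)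
    (hEan : ∀ g, ∀ z₀ : ℂ, 1 < z₀.re → z₀ ∉ P → AnalyticAt ℂ (fun z => Ec z g) z₀)
    (hE4 : ∀ z : ℂ, 1 < z.re → z ∉ P → Continuous (Ec z))
    (hEbd : ∀ z₀ : ℂ, 1 < z₀.re → z₀ ∉ P → ∀ K : Set (quasiSplit (↥(maximalRealSubfield L)) L (IsCMField.complexConj L) 3).Adelic, IsCompact K →
      ∃ V ∈ 𝓝 z₀, ∃ M : ℝ, ∀ z ∈ V, ∀ g ∈ K, ‖Ec z g‖ ≤ M)
    (hEcinv : ∀ z : ℂ, 1 < z.re → z ∉ P → ∀ (γ : (quasiSplit (↥(maximalRealSubfield L)) L (IsCMField.complexConj L) 3).arithmeticSubgroup) (x : (quasiSplit (↥(maximalRealSubfield L)) L (IsCMField.complexConj L) 3).Adelic),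
      Ec z ((γ : (quasiSplit (↥(maximalRealSubfield L)) L (IsCMField.complexConj L) 3).Adelic) * x) = Ec z x)
    (hEeq : ∀ g, ∀ z : ℂ, 2 < z.re → Ec z g = eisensteinSeriesU (flatSectionU (fun _ : (quasiSplit (↥(maximalRealSubfield L)) L (IsCMField.complexConj L) 3).Adelic => φ₀) z) g)
    (cc : ℂ → ℂ) (hcan : ∀ z₀ : ℂ, 1 < z₀.re → z₀ ≠ 2 → AnalyticAt ℂ cc z₀) {r : ℂ} (hcres : Tendsto (fun z : ℂ => (z - 2) * cc z) (𝓝[≠] 2) (𝓝 r))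
    (hccE : ∀ z : ℂ, 2 < z.re → ∀ g : (quasiSplit (↥(maximalRealSubfield L)) L (IsCMField.complexConj L) 3).Adelic,
      borelConstantTerm ν 𝓕 (eisensteinSeriesU (flatSectionU (fun _ : (quasiSplit (↥(maximalRealSubfield L)) L (IsCMField.complexConj L) 3).Adelic => φ₀) z)) g =
        φ₀ * ((((borelHeight g : ℝ≥0) : ℝ) : ℂ) ^ z + cc z * (((borelHeight g : ℝ≥0) : ℝ) : ℂ) ^ (2 - z)))
    (Fam : ℂ → (quasiSplit (↥(maximalRealSubfield L)) L (IsCMField.complexConj L) 3).L2 μ) (hFd : DifferentiableOn ℂ Fam ({z : ℂ | 1 < z.re} \ P))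
    (hFam : ∀ z : ℂ, 1 < z.re → z ∉ P → ((Fam z : (quasiSplit (↥(maximalRealSubfield L)) L (IsCMField.complexConj L) 3).L2 μ) : (quasiSplit (↥(maximalRealSubfield L)) L (IsCMField.complexConj L) 3).automorphicQuotient → ℂ) =ᵐ[μ]
      (quasiSplit (↥(maximalRealSubfield L)) L (IsCMField.complexConj L) 3).quotFun (truncation ν 𝓕 T (Ec z)))
    (hMS2 : ∃ C : ℝ, ∀ᶠ z in 𝓝[≠] (2 : ℂ), ‖(z - 2) • Fam z‖ ≤ C)
    (hMSP : ∀ z₀ ∈ P, 1 < z₀.re → z₀ ≠ 2 → ∃ C : ℝ, ∀ᶠ z in 𝓝[≠] z₀, ‖Fam z‖ ≤ C) :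
    (∀ g : (quasiSplit (↥(maximalRealSubfield L)) L (IsCMField.complexConj L) 3).Adelic, ∃ G : ℂ → ℂ, AnalyticAt ℂ G 2 ∧ G =ᶠ[𝓝[≠] 2] (fun z => Ec z g -
      φ₀ * ((((borelHeight g : ℝ≥0) : ℝ) : ℂ) ^ z + cc z * (((borelHeight g : ℝ≥0) : ℝ) : ℂ) ^ ((2 : ℂ) - z)))) ∧
    ∀ g : (quasiSplit (↥(maximalRealSubfield L)) L (IsCMField.complexConj L) 3).Adelic, ∀ z₀ : ℂ, 1 < z₀.re → z₀ ∈ P → z₀ ≠ 2 → ∃ C : ℝ, ∀ᶠ z in 𝓝[≠] z₀, ‖Ec z g‖ ≤ C := by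
  haveI := t2Space_adeleRing_of_numberField L
  haveI := locallyCompactSpace_adeleRing' L
  haveI := secondCountableTopology_adeleRing L
  haveI : T2Space (quasiSplit (↥(maximalRealSubfield L)) L (IsCMField.complexConj L) 3).Adelic :=
    inferInstanceAs (T2Space (adelic (↥(maximalRealSubfield L)) L (IsCMField.complexConj L) 3 ((StdForm.antidiagonal 3).over L)))
  haveI : LocallyCompactSpace (quasiSplit (↥(maximalRealSubfield L)) L (IsCMField.complexConj L) 3).Adelic :=
    inferInstanceAs (LocallyCompactSpace (adelic (↥(maximalRealSubfield L)) L (IsCMField.complexConj L) 3 ((StdForm.antidiagonal 3).over L)))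
  haveI : SecondCountableTopology (quasiSplit (↥(maximalRealSubfield L)) L (IsCMField.complexConj L) 3).Adelic :=
    inferInstanceAs (SecondCountableTopology (adelic (↥(maximalRealSubfield L)) L (IsCMField.complexConj L) 3 ((StdForm.antidiagonal 3).over L)))
  haveI : (haar : Measure (quasiSplit (↥(maximalRealSubfield L)) L (IsCMField.complexConj L) 3).Adelic).IsMulRightInvariant :=
    forall_isHaarMeasure_isMulRightInvariant_quasiSplit_cm L (by norm_num : 2 ≤ 3) haar inferInstance
  haveI : (haar : Measure (quasiSplit (↥(maximalRealSubfield L)) L (IsCMField.complexConj L) 3).Adelic).IsInvInvariant := isInvInvariant_of_isMulRightInvariant _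
  -- the domain `D = {1 < re} ∖ P`: open, preconnected, with the ball `B(3,1)` of the tube and a punctured ball around `2`
  set D : Set ℂ := {z : ℂ | 1 < z.re} \ P with hDdef
  have hDo : IsOpen D := (isOpen_lt continuous_const Complex.continuous_re).sdiff hPcl
  have hDc : IsPreconnected D := isPreconnected_convex_diff_of_countable Literature.Topology.Euclidean.one_lt_rank_real_complex (convex_halfSpace_re_gt 1)
    (isOpen_lt continuous_const Complex.continuous_re) hPc
  have hσ₀ : (2 : ℝ) < 3 := by norm_num
  have hσD : ∀ᶠ z in 𝓝 (((3 : ℝ) : ℝ) : ℂ), z ∈ D := by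
    have hball : ball (((3 : ℝ) : ℝ) : ℂ) 1 ∈ 𝓝 (((3 : ℝ) : ℝ) : ℂ) := ball_mem_nhds _ one_pos
    filter_upwards [hball] with z hz
    rw [mem_ball, Complex.dist_eq] at hz
    have h2 : 2 < z.re := by
      have h1 : |z.re - 3| ≤ ‖z - ((3 : ℝ) : ℂ)‖ := by simpa only [Complex.sub_re, Complex.ofReal_re] using Complex.abs_re_le_norm (z - ((3 : ℝ) : ℂ))
      have := (abs_lt.1 (h1.trans_lt hz)).1; linarith
    exact ⟨by show 1 < z.re; linarith, fun hP => by have := hP2 z hP; linarith⟩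
  obtain ⟨ρ, hρ, hρD⟩ : ∃ ρ : ℝ, 0 < ρ ∧ ∀ z : ℂ, z ≠ 2 → dist z 2 < ρ → z ∈ D := by
    obtain ⟨ε, hε, hεP⟩ := Metric.eventually_nhds_iff_ball.1 (eventually_nhdsWithin_iff.1 (hPiso 2 h2P))
    refine ⟨min ε 1, lt_min hε one_pos, fun z hz2 hz => ⟨?_, hεP z (mem_ball.2 (hz.trans_le (min_le_left _ _))) hz2⟩⟩
    show 1 < z.re
    have h1 : |z.re - 2| ≤ dist z 2 := by
      rw [Complex.dist_eq]; simpa only [Complex.sub_re, Complex.re_ofNat] using Complex.abs_re_le_norm (z - 2)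
    have := (abs_lt.1 (h1.trans_lt (hz.trans_le (min_le_right _ _)))).1; linarith
  have hD2 : ∀ᶠ z in 𝓝[≠] (2 : ℂ), z ∈ D := by
    filter_upwards [inter_mem_nhdsWithin _ (ball_mem_nhds (2 : ℂ) hρ)] with z hz
    exact hρD z hz.1 (mem_ball.1 hz.2)
  -- the EXPORTS letters on `D`
  have hEd : ∀ g, DifferentiableOn ℂ (fun z => Ec z g) D := fun g z hz => (hEan g z hz.1 hz.2).differentiableAt.differentiableWithinAt
  have hE4D : ∀ z ∈ D, Continuous (Ec z) := fun z hz => hE4 z hz.1 hz.2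
  have hEbdD : ∀ z₀ ∈ D, ∀ K : Set (quasiSplit (↥(maximalRealSubfield L)) L (IsCMField.complexConj L) 3).Adelic, IsCompact K →
      ∃ V ∈ 𝓝 z₀, ∃ M : ℝ, ∀ z ∈ V, ∀ g ∈ K, ‖Ec z g‖ ≤ M := fun z₀ hz₀ K hK => hEbd z₀ hz₀.1 hz₀.2 K hK
  have hEcinvD : ∀ z ∈ D, ∀ (γ : (quasiSplit (↥(maximalRealSubfield L)) L (IsCMField.complexConj L) 3).arithmeticSubgroup) (x : (quasiSplit (↥(maximalRealSubfield L)) L (IsCMField.complexConj L) 3).Adelic),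
      Ec z ((γ : (quasiSplit (↥(maximalRealSubfield L)) L (IsCMField.complexConj L) 3).Adelic) * x) = Ec z x := fun z hz => hEcinv z hz.1 hz.2
  have hE2 : ∀ z ∈ D, 2 < z.re → Ec z = eisensteinSeriesU (flatSectionU (fun _ : (quasiSplit (↥(maximalRealSubfield L)) L (IsCMField.complexConj L) 3).Adelic => φ₀) z) :=
    fun z _ hz => funext fun g => hEeq g z hz
  have hFamD : ∀ z ∈ D, ((Fam z : (quasiSplit (↥(maximalRealSubfield L)) L (IsCMField.complexConj L) 3).L2 μ) : (quasiSplit (↥(maximalRealSubfield L)) L (IsCMField.complexConj L) 3).automorphicQuotient → ℂ) =ᵐ[μ]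
      (quasiSplit (↥(maximalRealSubfield L)) L (IsCMField.complexConj L) 3).quotFun (truncation ν 𝓕 T (Ec z)) := fun z hz => hFam z hz.1 hz.2
  -- the coefficient `c̃` on `D` and the continued constant term (E3′)
  have hcc : DifferentiableOn ℂ cc D := fun z hz => (hcan z hz.1 (fun h => hz.2 (h ▸ h2P))).differentiableAt.differentiableWithinAt
  have hchol : DifferentiableOn ℂ cc ({z : ℂ | 1 < z.re} \ {2}) := fun z hz => (hcan z hz.1 hz.2).differentiableAt.differentiableWithinAt
  have hE3 := borelConstantTerm_continued_eq_cm_three L ν h𝓕N h𝓕c φ₀ Ec hDo hDc hσ₀ hσD hEd hE4D hEbdD hE2 hcc (fun z _ hz g => hccE z hz g)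
  -- `(z−2)c̃(z)` is bounded near `2`
  have hcc2 : ∃ C : ℝ, ∀ᶠ z in 𝓝[≠] (2 : ℂ), ‖(z - 2) * cc z‖ ≤ C :=
    ⟨‖r‖ + 1, (hcres.norm.eventually (gt_mem_nhds (lt_add_one ‖r‖))).mono fun z hz => hz.le⟩
  -- a test function at a point `z₀` (★ P5b): continuous, compactly supported, left-`K_U`-invariant, `ĥ(z₀) ≠ 0`, `ĥ` continuous
  have htest : ∀ z₀ : ℂ, ∃ h : (quasiSplit (↥(maximalRealSubfield L)) L (IsCMField.complexConj L) 3).Adelic → ℝ, Continuous h ∧ HasCompactSupport h ∧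
      (∀ k : (quasiSplit (↥(maximalRealSubfield L)) L (IsCMField.complexConj L) 3).Adelic,
        adelicVal (↥(maximalRealSubfield L)) L (IsCMField.complexConj L) 3 ((StdForm.antidiagonal 3).over L) k ∈ standardMaximalCompactGL 3 L → ∀ x, h (k * x) = h x) ∧
      ContinuousAt (fun z : ℂ => ∫ x, ((h x : ℝ) : ℂ) * (((borelHeight x : ℝ≥0) : ℝ) : ℂ) ^ z ∂haar) z₀ ∧
      (∫ x, ((h x : ℝ) : ℂ) * (((borelHeight x : ℝ≥0) : ℝ) : ℂ) ^ z₀ ∂haar) ≠ 0 := by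
    intro z₀
    obtain ⟨h, hh, hhc, -, hK, -, hre⟩ := exists_biInvariant_one_pos_re_integral_pos (haar : Measure (quasiSplit (↥(maximalRealSubfield L)) L (IsCMField.complexConj L) 3).Adelic) z₀
    refine ⟨h, hh, hhc, fun k hk x => ?_, ?_, fun h0 => ?_⟩
    · have := hK k 1 hk (by rw [map_one]; exact one_mem _) x
      rwa [mul_one] at this
    · exact ((differentiable_integral_mul_borelHeight_cpow_cm L haar (Complex.continuous_ofReal.comp hh) (hhc.comp_left Complex.ofReal_zero)).continuous).continuousAt
    · rw [h0, Complex.zero_re] at hre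
      exact lt_irrefl _ hre
  -- (Hk) continued for a test function
  have hHk : ∀ {h : (quasiSplit (↥(maximalRealSubfield L)) L (IsCMField.complexConj L) 3).Adelic → ℝ}, Continuous h → HasCompactSupport h →
      (∀ k : (quasiSplit (↥(maximalRealSubfield L)) L (IsCMField.complexConj L) 3).Adelic,
        adelicVal (↥(maximalRealSubfield L)) L (IsCMField.complexConj L) 3 ((StdForm.antidiagonal 3).over L) k ∈ standardMaximalCompactGL 3 L → ∀ x, h (k * x) = h x) →
      ∀ z ∈ D, ∀ g : (quasiSplit (↥(maximalRealSubfield L)) L (IsCMField.complexConj L) 3).Adelic,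
        ∫ y, ((h y : ℝ) : ℂ) * Ec z (g * y) ∂haar = (∫ x, ((h x : ℝ) : ℂ) * (((borelHeight x : ℝ≥0) : ℝ) : ℂ) ^ z ∂haar) * Ec z g :=
    fun hh hhc hK => integral_mul_continued_eq_cm_three L haar hK hh hhc φ₀ Ec hDo hDc hσ₀ hσD hEd hE4D hEbdD hE2
  refine ⟨?_, ?_⟩
  · -- (i) the simple-pole letter (F) from `hMS2`, then the residue ★ p859768
    obtain ⟨h, hh, hhc, hK, hha, hha0⟩ := htest 2
    have hEd2 : ∀ g : (quasiSplit (↥(maximalRealSubfield L)) L (IsCMField.complexConj L) 3).Adelic, ∀ᶠ z in 𝓝[≠] (2 : ℂ), DifferentiableAt ℂ (fun z => Ec z g) z :=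
      fun g => hD2.mono fun z hz => (hEan g z hz.1 hz.2).differentiableAt
    have hFp := fun g => (exists_analyticAt_eventuallyEq_sub_mul_of_family_bound μ haar ν h𝓕N hT φ₀ hh hhc hha hha0 Ec hD2 hEcinvD (hHk hh hhc hK) cc hE3 Fam hFamD hcc2 hMS2 hEd2 g).2
    choose Fp hF hFE using hFp
    obtain ⟨Res, hRes⟩ := exists_tendsto_smul_sub_of_eventually_norm_le (hD2.mono fun z hz => hFd.differentiableAt (hDo.mem_nhds hz)) hMS2
    exact exists_analyticAt_remainder_cm_three L μ ν h𝓕N h𝓕c φ₀ hT Ec hDo hDc hσ₀ hσD hρ hρD hEd hE4D hEbdD hEcinvD hE2 hchol hcres hE3 Fp hF hFE Fam hFd hFamD Res hRes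
  · -- (ii) pole exclusion off `2`, pointwise, from `hMSP`
    intro g z₀ hz₀ hz₀P hz₀2
    obtain ⟨h, hh, hhc, hK, hha, hha0⟩ := htest z₀
    have hS : ∀ᶠ z in 𝓝[≠] z₀, z ∈ D := by
      filter_upwards [hPiso z₀ hz₀P, mem_nhdsWithin_of_mem_nhds ((isOpen_lt continuous_const Complex.continuous_re).mem_nhds hz₀)] with z hz hz1
      exact ⟨hz1, hz⟩
    have hccb : ∃ C : ℝ, ∀ᶠ z in 𝓝[≠] z₀, ‖cc z‖ ≤ C :=
      ⟨‖cc z₀‖ + 1, mem_nhdsWithin_of_mem_nhds (((hcan z₀ hz₀ hz₀2).continuousAt.norm.eventually (gt_mem_nhds (lt_add_one ‖cc z₀‖))).mono fun z hz => hz.le)⟩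
    exact exists_eventually_norm_le_of_family_bound μ haar ν h𝓕N hT φ₀ hh hhc hha hha0 Ec hS hEcinvD (hHk hh hhc hK) cc hE3 Fam hFamD hccb (hMSP z₀ hz₀P hz₀ hz₀2) g

/-- **THE CAPSTONE'S `hreg` FROM THE EXPORTS** (★ p859307's binder): under the letters of `hres_and_hbdd_cm_three_of_exports` plus meromorphy of `z ↦ Ẽ(z)(g)` on `{1 < re}` ((E1)), for every
`g` there is `R` holomorphic on `{1 < re}` with `E(φ₀H^z)(g) = φ₀(H(g)^z + c̃(z)H(g)^{2−z}) + R z` for `2 < Re z` — ★ p859395 `hreg_cm_three_of_letters` with `hbdd` and `hres` supplied by the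
previous theorem. [cite: MoeglinWaldspurger1995, IV.1.9–IV.1.11] [cite: Langlands1976, §7] -/
theorem hreg_cm_three_of_exports
    (μ : Measure (quasiSplit (↥(maximalRealSubfield L)) L (IsCMField.complexConj L) 3).automorphicQuotient) [(quasiSplit (↥(maximalRealSubfield L)) L (IsCMField.complexConj L) 3).IsAutomorphicMeasure μ]
    (ν : Measure ↥(adelicUnipotent (↥(maximalRealSubfield L)) L (IsCMField.complexConj L) 3)) [ν.IsHaarMeasure]
    {𝓕 : Set ↥(adelicUnipotent (↥(maximalRealSubfield L)) L (IsCMField.complexConj L) 3)}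
    (h𝓕N : IsFundamentalDomain ↥(rationalUnipotent (↥(maximalRealSubfield L)) L (IsCMField.complexConj L) 3) 𝓕 ν) (h𝓕c : IsCompact (closure 𝓕))
    (φ₀ : ℂ) {T : ℝ≥0} (hT : 1 ≤ T)
    (P : Set ℂ) (hPcl : IsClosed P) (hPc : P.Countable) (hP2 : ∀ z ∈ P, z.re ≤ 2) (h2P : (2 : ℂ) ∈ P) (hPiso : ∀ z₀ ∈ P, ∀ᶠ z in 𝓝[≠] z₀, z ∉ P)
    (Ec : ℂ → (quasiSplit (↥(maximalRealSubfield L)) L (IsCMField.complexConj L) 3).Adelic → ℂ)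
    (hEmer : ∀ g, ∀ z₀ : ℂ, 1 < z₀.re → MeromorphicAt (fun z => Ec z g) z₀)
    (hEan : ∀ g, ∀ z₀ : ℂ, 1 < z₀.re → z₀ ∉ P → AnalyticAt ℂ (fun z => Ec z g) z₀)
    (hE4 : ∀ z : ℂ, 1 < z.re → z ∉ P → Continuous (Ec z))
    (hEbd : ∀ z₀ : ℂ, 1 < z₀.re → z₀ ∉ P → ∀ K : Set (quasiSplit (↥(maximalRealSubfield L)) L (IsCMField.complexConj L) 3).Adelic, IsCompact K →
      ∃ V ∈ 𝓝 z₀, ∃ M : ℝ, ∀ z ∈ V, ∀ g ∈ K, ‖Ec z g‖ ≤ M)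
    (hEcinv : ∀ z : ℂ, 1 < z.re → z ∉ P → ∀ (γ : (quasiSplit (↥(maximalRealSubfield L)) L (IsCMField.complexConj L) 3).arithmeticSubgroup) (x : (quasiSplit (↥(maximalRealSubfield L)) L (IsCMField.complexConj L) 3).Adelic),
      Ec z ((γ : (quasiSplit (↥(maximalRealSubfield L)) L (IsCMField.complexConj L) 3).Adelic) * x) = Ec z x)
    (hEeq : ∀ g, ∀ z : ℂ, 2 < z.re → Ec z g = eisensteinSeriesU (flatSectionU (fun _ : (quasiSplit (↥(maximalRealSubfield L)) L (IsCMField.complexConj L) 3).Adelic => φ₀) z) g)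
    (cc : ℂ → ℂ) (hcan : ∀ z₀ : ℂ, 1 < z₀.re → z₀ ≠ 2 → AnalyticAt ℂ cc z₀) {r : ℂ} (hcres : Tendsto (fun z : ℂ => (z - 2) * cc z) (𝓝[≠] 2) (𝓝 r))
    (hccE : ∀ z : ℂ, 2 < z.re → ∀ g : (quasiSplit (↥(maximalRealSubfield L)) L (IsCMField.complexConj L) 3).Adelic,
      borelConstantTerm ν 𝓕 (eisensteinSeriesU (flatSectionU (fun _ : (quasiSplit (↥(maximalRealSubfield L)) L (IsCMField.complexConj L) 3).Adelic => φ₀) z)) g =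
        φ₀ * ((((borelHeight g : ℝ≥0) : ℝ) : ℂ) ^ z + cc z * (((borelHeight g : ℝ≥0) : ℝ) : ℂ) ^ (2 - z)))
    (Fam : ℂ → (quasiSplit (↥(maximalRealSubfield L)) L (IsCMField.complexConj L) 3).L2 μ) (hFd : DifferentiableOn ℂ Fam ({z : ℂ | 1 < z.re} \ P))
    (hFam : ∀ z : ℂ, 1 < z.re → z ∉ P → ((Fam z : (quasiSplit (↥(maximalRealSubfield L)) L (IsCMField.complexConj L) 3).L2 μ) : (quasiSplit (↥(maximalRealSubfield L)) L (IsCMField.complexConj L) 3).automorphicQuotient → ℂ) =ᵐ[μ]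
      (quasiSplit (↥(maximalRealSubfield L)) L (IsCMField.complexConj L) 3).quotFun (truncation ν 𝓕 T (Ec z)))
    (hMS2 : ∃ C : ℝ, ∀ᶠ z in 𝓝[≠] (2 : ℂ), ‖(z - 2) • Fam z‖ ≤ C)
    (hMSP : ∀ z₀ ∈ P, 1 < z₀.re → z₀ ≠ 2 → ∃ C : ℝ, ∀ᶠ z in 𝓝[≠] z₀, ‖Fam z‖ ≤ C) :
    ∀ g : (quasiSplit (↥(maximalRealSubfield L)) L (IsCMField.complexConj L) 3).Adelic, ∃ R : ℂ → ℂ, DifferentiableOn ℂ R {z : ℂ | 1 < z.re} ∧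
      ∀ z : ℂ, 2 < z.re → eisensteinSeriesU (flatSectionU (fun _ : (quasiSplit (↥(maximalRealSubfield L)) L (IsCMField.complexConj L) 3).Adelic => φ₀) z) g =
        φ₀ * ((((borelHeight g : ℝ≥0) : ℝ) : ℂ) ^ z + cc z * (((borelHeight g : ℝ≥0) : ℝ) : ℂ) ^ ((2 : ℂ) - z)) + R z := by
  obtain ⟨hres, hbdd⟩ := hres_and_hbdd_cm_three_of_exports L μ ν h𝓕N h𝓕c φ₀ hT P hPcl hPc hP2 h2P hPiso Ec hEan hE4 hEbd hEcinv hEeq cc hcan hcres hccE Fam hFd hFam hMS2 hMSP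
  exact hreg_cm_three_of_letters L φ₀ cc hcan Ec P hP2 hEmer (fun g z₀ hz₀ hz₀P _ => hEan g z₀ hz₀ hz₀P) hEeq (fun g z₀ hz₀ hz₀P hz₀2 => hbdd g z₀ hz₀ hz₀P hz₀2) hres

end Summit.HodgeConjecture.HodgeConjecture.Cruxes.H413.K2E1SphericalEisensteinRegularRemainderCMThreeOfExports

end
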